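import Summits.AtomisticToContinuum.BoseEinsteinCondensation.Theorems.BECGroundStateSOSPeriodicIRBoundFsumDCAdjoint
import Summits.AtomisticToContinuum.BoseEinsteinCondensation.Theorems.BECGroundStateSOSPeriodicIRBoundFsumExcitedPairs
import Summits.AtomisticToContinuum.BoseEinsteinCondensation.Theorems.BECGroundStateSOSPeriodicIRBoundFsumConePhaseUp
import Summits.AtomisticToContinuum.BoseEinsteinCondensation.Theorems.BECGroundStateSOSPeriodicIRBoundFsumDichotomy
import Literature.MathematicalPhysics.QuantumManyBody.TorusFockLayer
import HarnessLib

/-!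
# Crux `RichardsonAnchorBEC` (stmt-AtomisticToContinuum-14805), route `BECRichardsonGaudin`, line `registered` —
# stub `stub_bandBubbleLower`

Lower bound on the "band bubble"
`J_M(L) = (1/(2L³)) Σ_{m ∈ B_M ∖ {0}} 1/((2π/L)² |m|²)`, `B_M = {−M, …, M}³ ⊂ ℤ³`, `|m|² = Σ_j (m j)²`:
for `L > 0` and `M ≥ 1`, `J_M(L) ≥ M/(3π²L)`.

Paper step (pure lattice counting): every `m ∈ B_M ∖ {0}` has `0 < |m|² ≤ 3M²`, so each term is
`≥ 1/((2π/L)²·3M²) = L²/(12π²M²)`; there are `(2M+1)³ − 1 ≥ 8M³` terms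
(`Fintype.card_piFinset`, `Int.card_Icc`, `Finset.card_erase_of_mem`); hence the sum is
`≥ 8M³ · L²/(12π²M²)` and `J_M ≥ M/(3π²L)` (`Finset.card_nsmul_le_sum`). Mathlib only.
-/

noncomputable section

open MeasureTheory Filter
open scoped ENNReal NNReal ComplexConjugate BigOperators

namespace Summit.AtomisticToContinuum.BoseEinsteinCondensation.Cruxes.RichardsonAnchorBEC.Birth

open Literature.MathematicalPhysics.QuantumManyBody.BoseGas
open Summit.AtomisticToContinuum.BoseEinsteinCondensation.Cruxes.PeriodicIRBound.LinearPhFloorWagner.WF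

/-- Cardinality of the punctured momentum band `{−M, …, M}³ ∖ {0} ⊂ ℤ³`: it has `(2M+1)³ − 1`
elements. [folklore] -/
theorem card_momentumBox_erase_zero (M : ℕ) :
    ((Fintype.piFinset (fun _ : Fin 3 => Finset.Icc (-(M : ℤ)) M)).erase 0).card =
      (2 * M + 1) ^ 3 - 1 := by
  have hcardI : (Finset.Icc (-(M : ℤ)) M).card = 2 * M + 1 := by
    rw [Int.card_Icc]; omega
  have h0mem : (0 : Fin 3 → ℤ) ∈ Fintype.piFinset (fun _ : Fin 3 => Finset.Icc (-(M : ℤ)) M) := by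
    rw [Fintype.mem_piFinset]
    intro j
    simp only [Pi.zero_apply, Finset.mem_Icc]
    omega
  rw [Finset.card_erase_of_mem h0mem, Fintype.card_piFinset, Finset.prod_const, Finset.card_univ,
    Fintype.card_fin, hcardI]

/-- Termwise lower bound: for `m ∈ {−M, …, M}³ ∖ {0}` one has `0 < |m|² ≤ 3M²`, hence
`L²/(12π²M²) ≤ 1/((2π/L)²|m|²)` for `L > 0`, `M ≥ 1`. [folklore] -/
theorem bandBubble_term_lower (L : ℝ) (M : ℕ) (hL : 0 < L) (hM : 1 ≤ M) (m : Fin 3 → ℤ)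
    (hm : m ∈ (Fintype.piFinset (fun _ : Fin 3 => Finset.Icc (-(M : ℤ)) M)).erase 0) :
    L ^ 2 / (12 * Real.pi ^ 2 * (M : ℝ) ^ 2) ≤
      1 / ((2 * Real.pi / L) ^ 2 * ∑ j : Fin 3, ((m j : ℤ) : ℝ) ^ 2) := by
  rw [Finset.mem_erase, Fintype.mem_piFinset] at hm
  obtain ⟨hm0, hmB⟩ := hm
  -- `|m|² ≤ 3 M²`
  have hle : ∑ j : Fin 3, ((m j : ℤ) : ℝ) ^ 2 ≤ 3 * (M : ℝ) ^ 2 := by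
    have hj : ∀ j, ((m j : ℤ) : ℝ) ^ 2 ≤ (M : ℝ) ^ 2 := by
      intro j
      have h := hmB j
      rw [Finset.mem_Icc] at h
      have h1 : -(M : ℝ) ≤ ((m j : ℤ) : ℝ) := by exact_mod_cast h.1
      have h2 : ((m j : ℤ) : ℝ) ≤ (M : ℝ) := by exact_mod_cast h.2
      exact sq_le_sq' h1 h2
    calc ∑ j : Fin 3, ((m j : ℤ) : ℝ) ^ 2 ≤ ∑ _j : Fin 3, (M : ℝ) ^ 2 :=
          Finset.sum_le_sum fun j _ => hj j
      _ = 3 * (M : ℝ) ^ 2 := by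
          rw [Finset.sum_const, Finset.card_univ, Fintype.card_fin, nsmul_eq_mul, Nat.cast_ofNat]
  -- `0 < |m|²` since `m ≠ 0` is an integer vector
  have hpos : 0 < ∑ j : Fin 3, ((m j : ℤ) : ℝ) ^ 2 := by
    obtain ⟨j, hj⟩ := Function.ne_iff.mp hm0
    have hj' : ((m j : ℤ) : ℝ) ≠ 0 := by exact_mod_cast hj
    calc (0 : ℝ) < ((m j : ℤ) : ℝ) ^ 2 := by positivity
      _ ≤ ∑ j : Fin 3, ((m j : ℤ) : ℝ) ^ 2 :=
          Finset.single_le_sum (f := fun i => ((m i : ℤ) : ℝ) ^ 2) (fun i _ => sq_nonneg _)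
            (Finset.mem_univ j)
  have hpi := Real.pi_pos
  have hM' : (0 : ℝ) < M := Nat.cast_pos.mpr hM
  rw [div_le_div_iff₀ (by positivity) (mul_pos (by positivity) hpos)]
  have hid : L ^ 2 * ((2 * Real.pi / L) ^ 2 * ∑ j : Fin 3, ((m j : ℤ) : ℝ) ^ 2) =
      4 * Real.pi ^ 2 * ∑ j : Fin 3, ((m j : ℤ) : ℝ) ^ 2 := by
    field_simp
    ring
  rw [hid]
  have h4 := mul_le_mul_of_nonneg_left hle (by positivity : (0 : ℝ) ≤ 4 * Real.pi ^ 2)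
  linarith

/-- **Band bubble lower bound.** For `L > 0` and `M ≥ 1`,
`M/(3π²L) ≤ (1/(2L³)) Σ_{m ∈ {−M..M}³ ∖ {0}} 1/((2π/L)² Σ_j (m j)²)`:
each of the `(2M+1)³ − 1 ≥ 8M³` terms is at least `L²/(12π²M²)`. [folklore] -/
theorem stub_bandBubbleLower :
    ∀ (L : ℝ) (M : ℕ), 0 < L → 1 ≤ M →
      (M : ℝ) / (3 * Real.pi ^ 2 * L) ≤
        1 / (2 * L ^ 3) * ∑ m ∈ (Fintype.piFinset (fun _ : Fin 3 => Finset.Icc (-(M : ℤ)) M)).erase 0,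
          1 / ((2 * Real.pi / L) ^ 2 * ∑ j : Fin 3, ((m j : ℤ) : ℝ) ^ 2) := by
  intro L M hL hM
  set S := (Fintype.piFinset (fun _ : Fin 3 => Finset.Icc (-(M : ℤ)) M)).erase 0 with hS
  have hcardS : S.card = (2 * M + 1) ^ 3 - 1 := card_momentumBox_erase_zero M
  have hterm : ∀ m ∈ S, L ^ 2 / (12 * Real.pi ^ 2 * (M : ℝ) ^ 2) ≤
      1 / ((2 * Real.pi / L) ^ 2 * ∑ j : Fin 3, ((m j : ℤ) : ℝ) ^ 2) :=
    fun m hm => bandBubble_term_lower L M hL hM m hm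
  have hsum := Finset.card_nsmul_le_sum S
    (fun m => 1 / ((2 * Real.pi / L) ^ 2 * ∑ j : Fin 3, ((m j : ℤ) : ℝ) ^ 2)) _ hterm
  rw [nsmul_eq_mul] at hsum
  have h8 : (8 : ℝ) * (M : ℝ) ^ 3 ≤ S.card := by
    have h : 8 * M ^ 3 ≤ S.card := by
      rw [hcardS]
      have : (2 * M + 1) ^ 3 = 8 * M ^ 3 + 12 * M ^ 2 + 6 * M + 1 := by ring
      omega
    exact_mod_cast h
  have hpi := Real.pi_pos
  have hM' : (0 : ℝ) < M := Nat.cast_pos.mpr hM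
  calc (M : ℝ) / (3 * Real.pi ^ 2 * L)
      = 1 / (2 * L ^ 3) * ((8 * (M : ℝ) ^ 3) * (L ^ 2 / (12 * Real.pi ^ 2 * (M : ℝ) ^ 2))) := by
        field_simp
        ring
    _ ≤ 1 / (2 * L ^ 3) * ((S.card : ℝ) * (L ^ 2 / (12 * Real.pi ^ 2 * (M : ℝ) ^ 2))) := by
        gcongr
    _ ≤ 1 / (2 * L ^ 3) *
          ∑ m ∈ S, 1 / ((2 * Real.pi / L) ^ 2 * ∑ j : Fin 3, ((m j : ℤ) : ℝ) ^ 2) := by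
        gcongr

end Summit.AtomisticToContinuum.BoseEinsteinCondensation.Cruxes.RichardsonAnchorBEC.Birth

end
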